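import Summits.HodgeConjecture.CorCM.Census.OcticWeilFourfold
import Summits.HodgeConjecture.CorCM.OcticCurveFourfoldFrameTransfer
import HarnessLib

/-!
# COR-CM — `B × E` for a SIMPLE CM fourfold of WEIL TYPE (`k`-signature `(2,2)`, octic `F ⊇ k`): FRAME TRANSFER — under
# `2`-transitivity of `Aut(ℂ/k)` on the embeddings over `τ`, Galois-balanced weights of every product of copies are
# model-balanced

Cell `pub-hodgecm2` (COR-CM), seat b30 gen 19 (2026-08-21); count-neutral own lane OCTIC-WEIL22 (sequel of gen 18's
OCTIC-EB, `CorCM/OcticCurveFourfoldFrameTransfer.lean`, whose model map `toPt`, injectivity and conjugation lemmas are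
reused BY NAME).  Theorems only; no definition, no named fact, no `sorry`.

SETTING.  A family of CM fields `Kf : I → Type`, `k = Kf i₀` (`Hom(k, ℂ) = {τ, τ̄}`), the octic `F = Kf i₁ ⊇ i(k)`, two
slots `curveSlots₂ i₀ i₁ = (i₁, i₀)`, realisations `A₂ 0 = B ⊨ (F; Φ)`, `A₂ 1 = E ⊨ (k; {τ})` (`hΨ`).  The frame
`e : Hom(F, ℂ) ≃ Fin 4 × Bool` has `(e s).2 = [s ∘ i = τ]` (`he_sign`), `e s̄ = ((e s).1, ¬(e s).2)` (`he_conj`) and NOW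
`Φ = e⁻¹ phi₂`, `phi₂ = {(0,true), (1,true), (2,false), (3,false)}` (`hΦ`: `k`-SIGNATURE `(2,2)` — `B` is an abelian
fourfold of Weil type for `k`).  THE ONE GALOIS INPUT is `2`-TRANSITIVITY (`h2t`): for all pairs `a ≠ b` an automorphism
`ρ_{ab}` of `ℂ` with `ρ_{ab} ∘ e⁻¹(a,true) = e⁻¹(0,true)` and `ρ_{ab} ∘ e⁻¹(b,true) = e⁻¹(1,true)` — for a SIMPLE `B`
this is Dodson's theorem (`Gal(Fᶜ/ℚ) ≅ ℤ₂ × A₄` or `ℤ₂ × S₄`; sequel `CorCM/OcticWeilFourfoldTwoTransitiveOfSimple.lean`).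

* §1 `comp_tau_eq_of_realises₂` — such a `ρ` fixes `τ`; `snd_apply_comp_eq` — hence preserves all signs;
  `fst_apply_comp_eq_iff` — and maps the pair `a` to the pair `0`, the pair `b` to the pair `1`; so
  **`comp_mem_iff_of_realises₂`**: `ρ ∘ s ∈ Φ ⟺ inr (e s) ∈ phi₂Pre a b` and, on the curve, `ρ ∘ σ ∈ {τ} ⟺ σ = τ`;
* §2 **`modelBalanced₂_of_isGaloisBalancedAlg`** — an `Aut(ℂ)`-balanced weight of `X = ⨁_j A₂(κ j)` (Pohlmann's
  condition for the CM algebra `∏_j K_{κ j}`) is a balanced configuration of the model of `Census/OcticWeilFourfold`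
  (`ModelBalanced₂`: the twelve equations of the realisers `ρ_{ab}`) under `v = toPt e τ ∘ P`, `P (j, s) = (κ j, s)`.
HONEST FRAMING: nothing about the Hodge conjecture is concluded here; `HC_CM` is not asserted.
[cite: Pohlmann1968, Thm 1] [cite: GaoUllmo2025, Thm 3.1] [cite: Dodson1984, §3.3.2 Theorem] [cite: Shimura1998, §18.2 Lemma (i)]

## References
* [Pohlmann1968] H. Pohlmann, Ann. of Math. 88 (1968), Thm 1.  [GaoUllmo2025] Z. Gao, E. Ullmo, J. Inst. Math. Jussieu 25
  (2025), Thm 3.1 (3.2).  [Dodson1984] B. Dodson, Trans. AMS 283 (1984), §3.3.2 Theorem.  [Shimura1998] G. Shimura,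
  *Abelian varieties with complex multiplication and modular functions*, §8.2 Prop. 26, §18.2 Lemma (i).
-/

noncomputable section

open CategoryTheory CategoryTheory.Limits NumberField

namespace Summit.HodgeConjecture.CorCM.OcticWeilFourfold

open Literature.AlgebraicGeometry Literature.AlgebraicGeometry.Motives Literature.AlgebraicGeometry.HodgeTheory
open Literature.AlgebraicGeometry.ComplexMultiplication (IsCMTypeRealisation)
open Literature.AlgebraicGeometry.Pohlmann1968
open Literature.AlgebraicTopology.SingularHomology
open Literature.NumberTheory.ComplexMultiplication
open Summit.HodgeConjecture.CorCM.Census.OcticCurveFourfold (Pt sgn cj cj_inl cj_inr)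
open Summit.HodgeConjecture.CorCM.Census.OcticWeilFourfold (phi₂Pre phi₂ inl_mem_phi₂Pre inr_mem_phi₂Pre ModelBalanced₂)
open Summit.HodgeConjecture.CorCM.OcticCurveFourfold (toPt toPt_zero toPt_one comp_injective comp_conjugate fst_eq_fst_iff
  comp_eq_tau_iff_of_realises)
open Summit.HodgeConjecture.CorCM.DecicCurveFivefold (curveSlots₂ sigma_cases)
open Summit.HodgeConjecture.CorCM.DihedralSexticPairCurvePowers (ncard_sep_eq_card_filter)

open scoped Classical Pointwise

/-! ## §1 How a `2`-realiser acts -/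

section Transfer

variable {I : Type} {Kf : I → Type} [∀ i, Field (Kf i)]
  {i₀ i₁ : I} {e : (Kf i₁ →+* ℂ) ≃ Fin 4 × Bool} {τ : Kf i₀ →+* ℂ}
  (hττ : ComplexEmbedding.conjugate τ ≠ τ) (hk : ∀ σ : Kf i₀ →+* ℂ, σ = τ ∨ σ = ComplexEmbedding.conjugate τ)
  {i : Kf i₀ →+* Kf i₁}
  (he_sign : ∀ s : Kf i₁ →+* ℂ, (e s).2 = true ↔ s.comp i = τ)
  (he_conj : ∀ s : Kf i₁ →+* ℂ, e (ComplexEmbedding.conjugate s) = ((e s).1, !(e s).2))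

include he_sign in
/-- **A `2`-realiser fixes `τ`**: if `ρ ∘ e⁻¹(a, true) = e⁻¹(0, true)` then `ρ ∘ τ = τ` (both labels lie over `τ`).
[cite: Dodson1984, §3.1.1] -/
theorem comp_tau_eq_of_realises₂ (ρ : ℂ ≃+* ℂ) {a : Fin 4}
    (hρa : (ρ : ℂ →+* ℂ).comp (e.symm (a, true)) = e.symm (0, true)) : (ρ : ℂ →+* ℂ).comp τ = τ := by
  have ha : (e.symm (a, true)).comp i = τ := (he_sign _).1 (by rw [Equiv.apply_symm_apply])
  have h0 : (e.symm (0, true)).comp i = τ := (he_sign _).1 (by rw [Equiv.apply_symm_apply])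
  calc (ρ : ℂ →+* ℂ).comp τ = ((ρ : ℂ →+* ℂ).comp (e.symm (a, true))).comp i := by rw [RingHom.comp_assoc, ha]
    _ = τ := by rw [hρa, h0]

include hττ hk he_sign in
/-- **A `2`-realiser preserves all signs**: `(e (ρ ∘ s)).2 = (e s).2`. [cite: Dodson1984, §3.1.1] -/
theorem snd_apply_comp_eq (ρ : ℂ ≃+* ℂ) {a : Fin 4}
    (hρa : (ρ : ℂ →+* ℂ).comp (e.symm (a, true)) = e.symm (0, true)) (s : Kf i₁ →+* ℂ) :
    (e ((ρ : ℂ →+* ℂ).comp s)).2 = (e s).2 := by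
  have key : (e ((ρ : ℂ →+* ℂ).comp s)).2 = true ↔ (e s).2 = true := by
    rw [he_sign, he_sign, RingHom.comp_assoc, comp_eq_tau_iff_of_realises hττ hk he_sign ρ hρa (s.comp i)]
    exact ⟨fun h => of_decide_eq_true h, fun h => decide_eq_true h⟩
  cases h1 : (e ((ρ : ℂ →+* ℂ).comp s)).2 <;> cases h2 : (e s).2
  · rfl
  · exact absurd (key.2 h2) (by rw [h1]; exact Bool.false_ne_true)
  · exact absurd (key.1 h1) (by rw [h2]; exact Bool.false_ne_true)
  · rfl

include he_conj in
/-- **A `2`-realiser maps the pair of `e⁻¹ p` onto the pair of `e⁻¹ q` when `ρ ∘ e⁻¹ p = e⁻¹ q`**: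
`(e (ρ ∘ s)).1 = q.1 ⟺ (e s).1 = p.1` (`ρ` maps conjugate pairs to conjugate pairs, injectively).
[cite: Shimura1998, §18.2 Lemma (i)] -/
theorem fst_apply_comp_eq_iff [NumberField (Kf i₁)] [IsCMField (Kf i₁)] (ρ : ℂ ≃+* ℂ) {p q : Fin 4 × Bool}
    (hρ : (ρ : ℂ →+* ℂ).comp (e.symm p) = e.symm q) (s : Kf i₁ →+* ℂ) :
    (e ((ρ : ℂ →+* ℂ).comp s)).1 = q.1 ↔ (e s).1 = p.1 := by
  have hinj := comp_injective (K := Kf i₁) ρ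
  have eq : q.1 = (e ((ρ : ℂ →+* ℂ).comp (e.symm p))).1 := by rw [hρ, Equiv.apply_symm_apply]
  have ep : p.1 = (e (e.symm p)).1 := by rw [Equiv.apply_symm_apply]
  rw [eq, ep, fst_eq_fst_iff he_conj, fst_eq_fst_iff he_conj, ← comp_conjugate ρ s]
  exact ⟨fun h => h.elim (fun h => Or.inl (hinj h)) fun h => Or.inr (hinj h),
    fun h => h.elim (fun h => Or.inl (by rw [h])) fun h => Or.inr (by rw [h])⟩

variable {Φ₂ : ∀ j : Fin 2, CMType (Kf (curveSlots₂ i₀ i₁ j))}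
  (hΦ : ∀ s : Kf i₁ →+* ℂ, s ∈ (Φ₂ 0).1 ↔ Sum.inr (e s) ∈ phi₂)
  (hΨ : ∀ σ : Kf i₀ →+* ℂ, σ ∈ (Φ₂ (0 : Fin 1).succ).1 ↔ σ = τ)

include hττ hk he_sign he_conj hΦ in
/-- **How a `2`-realiser acts on the fourfold slot.**  If `ρ ∘ e⁻¹(a,true) = e⁻¹(0,true)` and
`ρ ∘ e⁻¹(b,true) = e⁻¹(1,true)` then `ρ ∘ s ∈ Φ ⟺ inr (e s) ∈ phi₂Pre a b`: `ρ` preserves signs and maps the pairs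
`a, b` to the pairs `0, 1` of the members of `Φ` over `τ`. [cite: GaoUllmo2025, Thm 3.1 (3.2)] [cite: Dodson1984, §3.1.1] -/
theorem comp_mem_iff_of_realises₂ [NumberField (Kf i₁)] [IsCMField (Kf i₁)] (ρ : ℂ ≃+* ℂ) {a b : Fin 4}
    (hρa : (ρ : ℂ →+* ℂ).comp (e.symm (a, true)) = e.symm (0, true))
    (hρb : (ρ : ℂ →+* ℂ).comp (e.symm (b, true)) = e.symm (1, true)) (s : Kf i₁ →+* ℂ) :
    (ρ : ℂ →+* ℂ).comp s ∈ (Φ₂ 0).1 ↔ Sum.inr (e s) ∈ phi₂Pre a b := by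
  have h2 := snd_apply_comp_eq hττ hk he_sign ρ hρa s
  have h0 : (e ((ρ : ℂ →+* ℂ).comp s)).1 = 0 ↔ (e s).1 = a := fst_apply_comp_eq_iff he_conj ρ hρa s
  have h1 : (e ((ρ : ℂ →+* ℂ).comp s)).1 = 1 ↔ (e s).1 = b := fst_apply_comp_eq_iff he_conj ρ hρb s
  rw [hΦ, phi₂, inr_mem_phi₂Pre, inr_mem_phi₂Pre, h2]
  simp only [ne_eq, h0, h1]

include hττ hk he_sign he_conj hΦ hΨ in
/-- **Membership read in the frame**: for a `2`-realiser `ρ` of `(a, b)`, `ρ ∘ x ∈ Φ₂ ↔ toPt x ∈ phi₂Pre a b` (on the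
curve slot `ρ` fixes `τ`, and `inl c ∈ phi₂Pre a b ↔ c = true`). [cite: GaoUllmo2025, Thm 3.1 (3.2)] -/
theorem comp_mem_iff_toPt_mem₂ [NumberField (Kf i₁)] [IsCMField (Kf i₁)] {ρ : ℂ ≃+* ℂ} {a b : Fin 4}
    (hρa : (ρ : ℂ →+* ℂ).comp (e.symm (a, true)) = e.symm (0, true))
    (hρb : (ρ : ℂ →+* ℂ).comp (e.symm (b, true)) = e.symm (1, true))
    (x : (j : Fin 2) × (Kf (curveSlots₂ i₀ i₁ j) →+* ℂ)) :
    (ρ : ℂ →+* ℂ).comp x.2 ∈ (Φ₂ x.1).1 ↔ toPt e τ x ∈ phi₂Pre a b := by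
  rcases sigma_cases x with ⟨s, rfl⟩ | ⟨σ, rfl⟩
  · exact comp_mem_iff_of_realises₂ hττ hk he_sign he_conj hΦ ρ hρa hρb s
  · change (ρ : ℂ →+* ℂ).comp σ ∈ (Φ₂ (0 : Fin 1).succ).1 ↔ _
    rw [hΨ, toPt_one, inl_mem_phi₂Pre, comp_eq_tau_iff_of_realises hττ hk he_sign ρ hρa σ]

/-! ## §2 Frame transfer for the powers -/

variable {N : ℕ} (κ : Fin N → Fin 2)

include hττ hk he_sign he_conj hΦ hΨ in
/-- **FRAME TRANSFER FOR THE POWERS** (`2`-transitive case): an `Aut(ℂ)`-balanced weight of `X = ⨁_j A₂(κ j)`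
(`IsGaloisBalancedAlg` for the CM algebra `∏_j K_{κ j}`, types `Φ₂ (κ j)`) is a balanced configuration of the model
of `Census/OcticWeilFourfold` under `v = toPt e τ ∘ P`, `P (j, s) = (κ j, s)`: each ordered pair of distinct conjugate
pairs `(a, b)` is realised by an automorphism of `ℂ` fixing `τ` (`h2t`, `2`-transitivity), whose balance condition is
the model's equation for `(a, b)`. [cite: GaoUllmo2025, Thm 3.1 (3.2)] [cite: Pohlmann1968, Thm 1] [cite: Dodson1984, §3.3.2 Theorem] -/
theorem modelBalanced₂_of_isGaloisBalancedAlg [NumberField (Kf i₁)] [IsCMField (Kf i₁)]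
    (h2t : ∀ a b : Fin 4, a ≠ b → ∃ ρ : ℂ ≃+* ℂ,
      (ρ : ℂ →+* ℂ).comp (e.symm (a, true)) = e.symm (0, true) ∧ (ρ : ℂ →+* ℂ).comp (e.symm (b, true)) = e.symm (1, true))
    {S : Finset ((j : Fin N) × (Kf (curveSlots₂ i₀ i₁ (κ j)) →+* ℂ))}
    (hS : IsGaloisBalancedAlg (K := fun j => Kf (curveSlots₂ i₀ i₁ (κ j))) (fun j => Φ₂ (κ j)) S) :
    ModelBalanced₂ (fun x => toPt e τ ((Sigma.map κ (fun _ => id) :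
      ((j : Fin N) × (Kf (curveSlots₂ i₀ i₁ (κ j)) →+* ℂ)) → ((m : Fin 2) × (Kf (curveSlots₂ i₀ i₁ m) →+* ℂ))) x)) S := by
  intro a b hab
  beta_reduce
  obtain ⟨ρ, hρa, hρb⟩ := h2t a b hab
  have h := hS ρ
  rw [ncard_sep_eq_card_filter, ncard_sep_eq_card_filter] at h
  have key : ∀ x : (j : Fin N) × (Kf (curveSlots₂ i₀ i₁ (κ j)) →+* ℂ),
      (ρ : ℂ →+* ℂ).comp x.2 ∈ (Φ₂ (κ x.1)).1 ↔ toPt e τ ((Sigma.map κ (fun _ => id) :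
        ((j : Fin N) × (Kf (curveSlots₂ i₀ i₁ (κ j)) →+* ℂ)) → ((m : Fin 2) × (Kf (curveSlots₂ i₀ i₁ m) →+* ℂ))) x)
          ∈ phi₂Pre a b :=
    fun x => comp_mem_iff_toPt_mem₂ hττ hk he_sign he_conj hΦ hΨ hρa hρb ⟨κ x.1, x.2⟩
  rw [Finset.filter_congr fun x _ => key x, Finset.filter_congr fun x _ => (key x).not] at h
  have htot := Finset.card_filter_add_card_filter_not
    (s := S) (fun x => toPt e τ ((Sigma.map κ (fun _ => id) :
        ((j : Fin N) × (Kf (curveSlots₂ i₀ i₁ (κ j)) →+* ℂ)) → ((m : Fin 2) × (Kf (curveSlots₂ i₀ i₁ m) →+* ℂ))) x)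
          ∈ phi₂Pre a b)
  omega

end Transfer

end Summit.HodgeConjecture.CorCM.OcticWeilFourfold

end
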